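import Mathlib.RingTheory.GradedAlgebra.Basic
import Literature.AlgebraicGeometry.Resolution.CobordantBlowupFiltration

/-!
# S1a — H4a: the COARSE CHART of one weighted move — degree-0 trace, Veronese normalisation, chart ring [OURS · L1 W4.5c · idea-2 g15]

NOT a statement of the manuscript; counted 0. AI-level work, weaker than expert review. Part of the H3-SCHEME
(memo `h123/H3-SCHEME.md`, plan-1 RULING 2026-08-27T20:04:51Z (5)); ring level, tree imports only.

Setting: a ring `B` graded by an additive group `ι` (`𝒜 : ι → AddSubgroup B`, `GradedRing 𝒜`; the upstairs ring of a
node), a centre `f : Fin c → B` with weights `w`, its weighted filtration `𝒥ₙ = (weightedFiltration f w).ideal n`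
(Literature, [cite: Wlodarczyk2022, Lemma 2.1.9]) and full cobordant blow-up algebra `cobordantAlgebra f w = ⊕ₙ 𝒥ₙ Tⁿ`
([cite: Wlodarczyk2022, Def. 2.3.5]). The COARSE model of the move over the chart `Spec (𝒜 0)` is proposed to be the
ORDINARY blow-up of `Spec (𝒜 0)` along ONE piece `K d` of the DEGREE-0 TRACE `K n := 𝒥ₙ ∩ 𝒜 0`
(`traceFiltration`), at a VERONESE DEGREE `d` (`VeroneseNormalised`: `K (d l) = (K d)^l` for all `l`). This file:

* `traceFiltration 𝒜 f w : IdealFiltration ↥(𝒜 0)` — the degree-0 trace (PROVED to be an ideal filtration);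
* `VeroneseNormalised 𝒜 f w d`, and the statement **(G1a) `VeroneseNormalisation`**: for a grading with (T2) (finite
  generation of `B` over `𝒜 0`) and a homogeneous centre, a Veronese degree exists — STATEMENT ONLY (standard:
  finite generation of `⊕ₙ (𝒥ₙ)₀ tⁿ` over `𝒜 0` by a Dickson/Gordan argument on degrees, then Bourbaki AC III §1.3
  Prop. 3 = EGA II (2.1.6); neither is in Mathlib or the tree);
* `coverElement d b = C b * T d ∈ cobordantAlgebra f w` for `b ∈ K d` (PROVED), and the COARSE CHART RING
  `coarseChart 𝒜 f w d b hb` := the `𝒜 0`-subalgebra of `Localization.Away (coverElement …)` generated by the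
  fractions `x T^d / b T^d`, `x ∈ K d` — by construction a quotient of the affine blow-up algebra `(𝒜 0)[K d / b]`;
  (G1b) of the memo (= `coarseChart` is the whole bidegree-`(0,0)` part, given `VeroneseNormalised d`) is stated in
  H4c where the Rees bigrading `𝒜ʼ` of H3ʼs `ChartClause` is in scope.
-/

set_option linter.dupNamespace false

noncomputable section

open Literature.AlgebraicGeometry.Resolution
open scoped LaurentPolynomial

namespace Summit.ResolutionOfSingularities.ResolutionOfSingularities.Theorems.WildQuotientResolution.S1.CoarseChart

universe u v

variable {ι : Type v} [AddCommGroup ι] [DecidableEq ι] {B : Type u} [CommRing B]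
  (𝒜 : ι → AddSubgroup B) [GradedRing 𝒜] {c : ℕ} (f : Fin c → B) (w : Fin c → ℕ)

/-! ## The degree-0 trace of the weighted filtration -/

/-- **The degree-0 trace** `K n := 𝒥ₙ ∩ 𝒜 0` of the weighted filtration of the centre `(f, w)`, as an ideal
filtration of the degree-0 ring `𝒜 0` (the coordinate ring of the coarse chart). [OURS · L1 W4.5c] -/
def traceFiltration : IdealFiltration ↥(𝒜 0) where
  ideal n := ((weightedFiltration f w).ideal n).comap (algebraMap ↥(𝒜 0) B)
  ideal_zero := by
    rw [(weightedFiltration f w).ideal_zero, Ideal.comap_top]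
  antitone m n h := Ideal.comap_mono ((weightedFiltration f w).antitone h)
  mul_le m n := by
    rw [Ideal.mul_le]
    intro x hx y hy
    rw [Ideal.mem_comap, map_mul]
    exact (weightedFiltration f w).mul_le m n (Ideal.mul_mem_mul hx hy)

/-- Membership in the degree-`n` piece of the trace filtration: the element of `𝒜 0`, read in `B`, lies in the
degree-`n` piece of the weighted filtration. -/
theorem mem_traceFiltration_iff {n : ℕ} {x : ↥(𝒜 0)} :
    x ∈ (traceFiltration 𝒜 f w).ideal n ↔ (x : B) ∈ (weightedFiltration f w).ideal n :=
  Iff.rfl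

/-- A degree-0 centre element of weight `wᵢ` lies in `K wᵢ`. -/
theorem mem_traceFiltration_of_eq {i : Fin c} {x : ↥(𝒜 0)} (hx : (x : B) = f i) :
    x ∈ (traceFiltration 𝒜 f w).ideal (w i) := by
  rw [mem_traceFiltration_iff, hx]
  exact mem_weightedFiltration_ideal f w i

/-! ## (G1a) Veronese normalisation -/

/-- `d` is a **Veronese degree** for the degree-0 trace: `d > 0` and `K (d·l) = (K d)^l` for every `l`. Then
`Proj ⊕ₙ Kₙ = Bl_{K d} (Spec (𝒜 0))`, an ordinary blow-up. [OURS · L1 W4.5c] -/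
def VeroneseNormalised (d : ℕ) : Prop :=
  0 < d ∧ ∀ l : ℕ, (traceFiltration 𝒜 f w).ideal (d * l) = (traceFiltration 𝒜 f w).ideal d ^ l

/-- The easy inclusion `(K d)^l ≤ K (d·l)` holds for every `d` (it is an ideal filtration). -/
theorem pow_le_traceFiltration (d l : ℕ) :
    (traceFiltration 𝒜 f w).ideal d ^ l ≤ (traceFiltration 𝒜 f w).ideal (d * l) := by
  induction l with
  | zero => simp [(traceFiltration 𝒜 f w).ideal_zero]
  | succ l ih =>
    rw [pow_succ, Nat.mul_succ]
    exact (Ideal.mul_mono_left ih).trans ((traceFiltration 𝒜 f w).mul_le _ _)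

/-- **(G1a) VERONESE NORMALISATION — statement.** For a graded ring finitely generated over its degree-0 part (T2)
and a HOMOGENEOUS centre, the degree-0 trace of the weighted filtration has a Veronese degree. Standard commutative
algebra (finite generation of `⊕ₙ (𝒥ₙ)₀ tⁿ` over `𝒜 0` — Dickson/Gordan on the degree monoid — then Bourbaki AC III
§1 no. 3 Prop. 3 / EGA II (2.1.6)); not in Mathlib, not in the tree. STATEMENT ONLY. [OURS · L1 W4.5c] -/
def VeroneseNormalisation : Prop :=
  ∀ (ι : Type v) [AddCommGroup ι] [DecidableEq ι] (B : Type u) [CommRing B] (𝒜 : ι → AddSubgroup B)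
    [GradedRing 𝒜],
    (∃ t : Finset B, Subring.closure (((𝒜 0 : AddSubgroup B) : Set B) ∪ ↑t) = ⊤) →
    ∀ (c : ℕ) (f : Fin c → B) (δ : Fin c → ι) (w : Fin c → ℕ), (∀ i, f i ∈ 𝒜 (δ i)) →
      ∃ d : ℕ, VeroneseNormalised 𝒜 f w d

/-! ## The cover elements `b T^d` and the coarse chart ring -/

/-- `b T^d` lies in the cobordant algebra when `b ∈ 𝒥_d`. -/
theorem C_mul_T_mem_cobordantAlgebra {d : ℕ} {b : B} (hb : b ∈ (weightedFiltration f w).ideal d) :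
    LaurentPolynomial.C b * LaurentPolynomial.T (d : ℤ) ∈ cobordantAlgebra f w := by
  rw [cobordantAlgebra_eq_extendedRees]
  exact (weightedFiltration f w).C_mul_T_mem_extendedRees_iff.mpr hb

/-- **The cover element** `b T^d ∈ R^w = cobordantAlgebra f w` of a degree-0 element `b ∈ K d` (bidegree `(d, 0)`).
[OURS · L1 W4.5c] -/
def coverElement (d : ℕ) (b : ↥(𝒜 0)) (hb : b ∈ (traceFiltration 𝒜 f w).ideal d) : ↥(cobordantAlgebra f w) :=
  ⟨LaurentPolynomial.C (b : B) * LaurentPolynomial.T (d : ℤ), C_mul_T_mem_cobordantAlgebra f w hb⟩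

/-- The cover element `b·T^d`, read in `B[T, T⁻¹]`. -/
@[simp] theorem coe_coverElement (d : ℕ) (b : ↥(𝒜 0)) (hb : b ∈ (traceFiltration 𝒜 f w).ideal d) :
    ((coverElement 𝒜 f w d b hb : ↥(cobordantAlgebra f w)) : B[T;T⁻¹]) =
      LaurentPolynomial.C (b : B) * LaurentPolynomial.T (d : ℤ) := rfl

/-- The chart ring `R^w[(b T^d)⁻¹]` as an `𝒜 0`-algebra (through `𝒜 0 → B → R^w → R^w[h⁻¹]`). -/
abbrev ChartRing (d : ℕ) (b : ↥(𝒜 0)) (hb : b ∈ (traceFiltration 𝒜 f w).ideal d) : Type u :=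
  Localization.Away (coverElement 𝒜 f w d b hb)

/-- The structure map `𝒜 0 →+* R^w[(b T^d)⁻¹]`. -/
def toChartRing (d : ℕ) (b : ↥(𝒜 0)) (hb : b ∈ (traceFiltration 𝒜 f w).ideal d) :
    ↥(𝒜 0) →+* ChartRing 𝒜 f w d b hb :=
  (algebraMap (↥(cobordantAlgebra f w)) (ChartRing 𝒜 f w d b hb)).comp
    ((algebraMap B (↥(cobordantAlgebra f w))).comp (algebraMap (↥(𝒜 0)) B))

/-- The fraction `x T^d / b T^d` of the chart ring, for `x ∈ K d`. -/
def chartFraction (d : ℕ) (b : ↥(𝒜 0)) (hb : b ∈ (traceFiltration 𝒜 f w).ideal d) (x : ↥(𝒜 0))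
    (hx : x ∈ (traceFiltration 𝒜 f w).ideal d) : ChartRing 𝒜 f w d b hb :=
  IsLocalization.mk' (ChartRing 𝒜 f w d b hb) (coverElement 𝒜 f w d x hx)
    ⟨coverElement 𝒜 f w d b hb, Submonoid.mem_powers _⟩

/-- `(x T^d / b T^d) · (b T^d) = x T^d`. -/
theorem chartFraction_mul (d : ℕ) (b : ↥(𝒜 0)) (hb : b ∈ (traceFiltration 𝒜 f w).ideal d) (x : ↥(𝒜 0))
    (hx : x ∈ (traceFiltration 𝒜 f w).ideal d) :
    chartFraction 𝒜 f w d b hb x hx * algebraMap _ (ChartRing 𝒜 f w d b hb) (coverElement 𝒜 f w d b hb) =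
      algebraMap _ (ChartRing 𝒜 f w d b hb) (coverElement 𝒜 f w d x hx) :=
  IsLocalization.mk'_spec (ChartRing 𝒜 f w d b hb) _ _

/-- **The coarse chart ring** of the move over `Spec (𝒜 0)` at the cover element `b T^d`: the subring of
`R^w[(b T^d)⁻¹]` generated over `𝒜 0` by the fractions `x T^d / b T^d`, `x ∈ K d` — the image of the affine
blow-up algebra `(𝒜 0)[K d / b]`. With `d` a Veronese degree it is the whole bidegree-`(0,0)` part (memo (G1b), stated
in H4c). [OURS · L1 W4.5c] -/
def coarseChart (d : ℕ) (b : ↥(𝒜 0)) (hb : b ∈ (traceFiltration 𝒜 f w).ideal d) :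
    Subring (ChartRing 𝒜 f w d b hb) :=
  Subring.closure (Set.range (toChartRing 𝒜 f w d b hb) ∪
    {z | ∃ (x : ↥(𝒜 0)) (hx : x ∈ (traceFiltration 𝒜 f w).ideal d), z = chartFraction 𝒜 f w d b hb x hx})

/-- The structure map `𝒜 0 → ChartRing` lands in the coarse chart. -/
theorem toChartRing_mem_coarseChart (d : ℕ) (b : ↥(𝒜 0)) (hb : b ∈ (traceFiltration 𝒜 f w).ideal d)
    (x : ↥(𝒜 0)) : toChartRing 𝒜 f w d b hb x ∈ coarseChart 𝒜 f w d b hb :=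
  Subring.subset_closure (Or.inl ⟨x, rfl⟩)

/-- Every chart fraction `x / b` (`x` of trace degree `≥ d`) lies in the coarse chart. -/
theorem chartFraction_mem_coarseChart (d : ℕ) (b : ↥(𝒜 0)) (hb : b ∈ (traceFiltration 𝒜 f w).ideal d)
    (x : ↥(𝒜 0)) (hx : x ∈ (traceFiltration 𝒜 f w).ideal d) :
    chartFraction 𝒜 f w d b hb x hx ∈ coarseChart 𝒜 f w d b hb :=
  Subring.subset_closure (Or.inr ⟨x, hx, rfl⟩)

end Summit.ResolutionOfSingularities.ResolutionOfSingularities.Theorems.WildQuotientResolution.S1.CoarseChart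

end
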